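import Literature.NumberTheory.LFunctions.SelbergClassLogDerivDifference
import Literature.NumberTheory.LFunctions.SelbergClassConvexityBound
import Mathlib.Analysis.Complex.JensenFormula
import Literature.Analysis.SpecialFunctions.DigammaLogBound
import Literature.Analysis.Complex.LogDerivZerosDisc
import HarnessLib

/-!
# The Selberg class: zero counting in unit windows and `Φ'/Φ` near the critical line

General API for `Literature.NumberTheory.LFunctions.SelbergDatum`, all proved, serving the
formalisation of Soundararajan's strong multiplicity one theorem
(`SelbergClassStrongMultiplicityOne.lean`; layer 6):

* `SelbergDatum.exists_exp_neg_le_norm_toFun` — `|F(s)| ≥ e^{−M₂}` on `re s ≥ 2` (Euler product).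
* `SelbergDatum.meromorphicOrderAt_completed_eq_of_entire` — on the open critical strip the
  multiplicity of `Φ` is that of the entire function `(s−1)^m F(s)`.
* `SelbergDatum.exists_norm_entire_le` — the convexity bound for `(s−1)^m F(s)` including `s = 1`.
* `SelbergDatum.exists_sum_order_window_le` — **`O(log t)` zeros (with multiplicity) in every window
  `{0 < re s < 1, t ≤ im s ≤ t+1}`** (Jensen's inequality `AnalyticOnNhd.sum_divisor_le` + convexity).
* `SelbergDatum.exists_norm_sum_digamma_le` — the gamma part of `Φ'/Φ` is `O(log t)` near the line.
* `Soundararajan2004.exists_height_far_from` — a height in `[t, t+1]` at distance `≥ 1/(2(#Z+1))`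
  from finitely many ordinates (measure count).
* `SelbergDatum.exists_logDeriv_completed_le` — **`Φ'/Φ(z) = O(log t) + ∑_{|ρ−c|≤3} m(ρ)/|z−ρ|`**
  on the window, off the zeros (Landau's lemma `Literature.Analysis.Complex.norm_logDeriv_sub_sum_le`,
  Titchmarsh §3.9 Lemma α).
* `Soundararajan2004.exists_good_height` — **good heights for a pair**: every `[t, t+1]` contains
  `T'` with the segment `1/4 ≤ re s ≤ 3/4`, `im s = T'` free of zeros of `Φ_F Φ_G` and
  `‖Φ_F'/Φ_F‖ + ‖Φ_G'/Φ_G‖ ≤ C log²(2+|t|)` there (horizontal edges of the explicit-formula rectangle).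

These are the local forms of the zero-counting statement "`#{ρ_F : |im ρ_F| ≤ T} = (d_F/π)T log T +
c_F T + O(log T)`" quoted on p. 2 of the source, which is all that its proof uses.

## References

* K. Soundararajan, *Strong multiplicity one for the Selberg class*, Canad. Math. Bull. 47 (2004)
  468–474; arXiv:math/0210299, p. 2. [Soundararajan2002]
* E. C. Titchmarsh, *The Theory of the Riemann Zeta-Function*, 2nd ed. (1986), §3.9 Lemma α,
  §9.2, §9.4. [Titchmarsh1986]
-/

noncomputable section

open Complex Filter Topology Set Asymptotics Metric MeromorphicOn
open scoped ComplexConjugate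

namespace Literature.NumberTheory.LFunctions

namespace SelbergDatum

variable (D : SelbergDatum)

/-- **A uniform lower bound for `|F|` on `re s ≥ 2`**: `e^{-M₂} ≤ ‖F(s)‖` with
`M₂ = ∑ |b(n)| n^{-2}` (Euler product, axiom (v)). [folklore] -/
theorem exists_exp_neg_le_norm_toFun :
    ∃ M₂ : ℝ, 0 ≤ M₂ ∧ ∀ s : ℂ, 2 ≤ s.re → Real.exp (-M₂) ≤ ‖D.toFun s‖ := by
  obtain ⟨b, θ, -, hb, hO, hexp⟩ := D.euler_product
  have hsum : ∀ s : ℂ, 1 < s.re → LSeriesSummable b s := fun s hs ↦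
    D.LSeriesSummable_euler hb hO hexp hs
  have h2 : LSeriesSummable b 2 := hsum 2 (by norm_num)
  refine ⟨∑' n, ‖LSeries.term b 2 n‖, tsum_nonneg fun n ↦ norm_nonneg _, fun s hs ↦ ?_⟩
  have hs1 : 1 < s.re := by linarith
  have hle : ∀ n, ‖LSeries.term b s n‖ ≤ ‖LSeries.term b 2 n‖ := fun n ↦
    LSeries.norm_term_le_of_re_le_re b (by simpa using hs) n
  have hsn : Summable fun n ↦ ‖LSeries.term b s n‖ := (hsum s hs1).norm
  have htsum : ∑' n, ‖LSeries.term b s n‖ ≤ ∑' n, ‖LSeries.term b 2 n‖ :=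
    hsn.tsum_le_tsum hle h2.norm
  exact (Real.exp_le_exp.mpr (by linarith)).trans (D.exp_neg_le_norm_toFun_euler hsum hexp hs1).1

/-- On the open critical strip the multiplicity of `Φ` at `ρ` is that of the entire function
`(s − 1)^m F(s)` (the gamma factor and `(s − 1)^m` are analytic units there). [folklore] -/
theorem meromorphicOrderAt_completed_eq_of_entire {G : ℂ → ℂ} (hG : Differentiable ℂ G)
    (hGF : ∀ s, s ≠ 1 → G s = (s - 1) ^ D.polarOrder * D.toFun s)
    {ρ : ℂ} (hρ₀ : 0 < ρ.re) (hρ₁ : ρ.re < 1) :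
    meromorphicOrderAt D.completed ρ = meromorphicOrderAt G ρ := by
  have hρne : ρ ≠ 1 := by rintro rfl; simp at hρ₁
  have hΦ : AnalyticAt ℂ D.completed ρ := D.analyticOnNhd_completed ρ ⟨hρ₀, hρne⟩
  have hGan : AnalyticAt ℂ G ρ := hG.analyticAt ρ
  rw [hΦ.meromorphicOrderAt_eq, hGan.meromorphicOrderAt_eq]
  congr 1
  have hopen : IsOpen {z : ℂ | 0 < z.re ∧ z ≠ 1} :=
    (isOpen_lt continuous_const continuous_re).inter isOpen_ne
  have hu : AnalyticAt ℂ (fun z ↦ D.gammaFactor z / (z - 1) ^ D.polarOrder) ρ :=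
    (D.analyticOnNhd_gammaFactor ρ hρ₀).div ((analyticAt_id.sub analyticAt_const).pow _)
      (pow_ne_zero _ (sub_ne_zero.mpr hρne))
  refine Soundararajan2004.analyticOrderAt_eq_of_eventuallyEq_mul hGan hu
    (div_ne_zero (D.gammaFactor_ne_zero hρ₀) (pow_ne_zero _ (sub_ne_zero.mpr hρne))) ?_
  filter_upwards [hopen.mem_nhds ⟨hρ₀, hρne⟩] with z hz
  rw [D.completed_eq_gammaFactor_mul, hGF z hz.2]
  field_simp [pow_ne_zero _ (sub_ne_zero.mpr hz.2)]

/-- The convexity bound for the entire function `(s−1)^m F(s)`, including the point `s = 1`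
(by continuity). [folklore] -/
theorem exists_norm_entire_le (σ₁ σ₂ : ℝ) {G : ℂ → ℂ} (hG : Differentiable ℂ G)
    (hGF : ∀ s, s ≠ 1 → G s = (s - 1) ^ D.polarOrder * D.toFun s) :
    ∃ C A : ℝ, 0 < C ∧ 0 ≤ A ∧ ∀ s : ℂ, σ₁ ≤ s.re → s.re ≤ σ₂ → ‖G s‖ ≤ C * (1 + |s.im|) ^ A := by
  obtain ⟨C, A, hC, hA, h⟩ := D.exists_norm_pow_mul_toFun_le σ₁ σ₂
  refine ⟨C, A, hC, hA, fun s hs₁ hs₂ ↦ ?_⟩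
  by_cases hs : s = 1
  · -- limit along `1 + iy`, `y → 0`, `y ≠ 0`
    subst hs
    have hσ₁ : σ₁ ≤ 1 := by simpa using hs₁
    have hσ₂ : 1 ≤ σ₂ := by simpa using hs₂
    set φ : ℝ → ℝ := fun y ↦ ‖G (1 + y * I)‖ - C * (1 + |y|) ^ A with hφ
    have hφc : Continuous φ := by
      simp only [hφ]
      refine (continuous_norm.comp (hG.continuous.comp (by fun_prop))).sub ?_
      exact continuous_const.mul ((continuous_const.add continuous_abs).rpow_const
        fun y ↦ Or.inl (by linarith [abs_nonneg y] : (1 : ℝ) + |y| ≠ 0))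
    have hev : ∀ᶠ y : ℝ in 𝓝[≠] 0, φ y ≤ 0 := by
      refine eventually_nhdsWithin_of_forall fun y hy ↦ ?_
      have hne : (1 : ℂ) + y * I ≠ 1 := by
        intro h0; apply hy
        have := congrArg Complex.im h0; simpa using this
      have := h (1 + y * I) (by simpa using hσ₁) (by simpa using hσ₂) hne
      rw [← hGF _ hne] at this
      simp only [hφ, sub_nonpos]
      simpa using this
    have hlim : Tendsto φ (𝓝[≠] 0) (𝓝 (φ 0)) := (hφc.tendsto 0).mono_left nhdsWithin_le_nhds
    have h0 := le_of_tendsto hlim hev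
    simp only [hφ, sub_nonpos] at h0
    simpa using h0
  · rw [hGF s hs]; exact h s hs₁ hs₂ hs

set_option maxHeartbeats 800000 in
/-- **Zero counting in unit windows: `O(log t)` zeros per unit height.** There is `C = C(F) > 0`
such that for every real `t` and every finite set `S` of points of the window
`{0 < re s < 1, t ≤ im s ≤ t + 1}`: `∑_{ρ ∈ S} m(ρ) ≤ C log(2 + |t|)`, `m(ρ)` the multiplicity of
`Φ` at `ρ` (zero if `Φ(ρ) ≠ 0`). Proof: Jensen's inequality (Mathlib's `AnalyticOnNhd.sum_divisor_le`)
for the entire function `(s−1)^m F(s)` on the discs of radii `5/2 < 5` about `2 + i(t + 1/2)`, the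
convexity bound `SelbergDatum.exists_norm_pow_mul_toFun_le` on the big circle and the Euler-product
lower bound at the centre. This is the local form of the zero-counting asymptotics quoted on p. 2 of
the source ("there are `≪ T log T` ordinates `γ_F` or `γ_G` in `[T, 2T]`"; "the number of ordinates
whose distance from `(T, 2T)` is between `n` and `n+1` is `≪ log(T(n+1))`").
[cite: Soundararajan2002, p. 2] -/
theorem exists_sum_order_window_le :
    ∃ C : ℝ, 0 < C ∧ ∀ (t : ℝ) (S : Finset ℂ),
      (∀ ρ ∈ S, 0 < ρ.re ∧ ρ.re < 1 ∧ t ≤ ρ.im ∧ ρ.im ≤ t + 1) →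
      ∑ ρ ∈ S, ((meromorphicOrderAt D.completed ρ).untop₀ : ℝ) ≤ C * Real.log (2 + |t|) := by
  classical
  obtain ⟨G, hG, hGF⟩ := D.differentiable
  obtain ⟨Cv, A, hCv, hA, hconv⟩ := D.exists_norm_entire_le (-3) 7 hG hGF
  obtain ⟨M₂, hM₂, hlow⟩ := D.exists_exp_neg_le_norm_toFun
  have hlog2 : 0 < Real.log 2 := Real.log_pos one_lt_two
  -- constant: `(log Cv⁺ + 4A + M₂ + 1)/log 2`, using `log(8 + |t|) ≤ 4 log(2 + |t|)`
  set C : ℝ := (|Real.log Cv| + 4 * A + M₂ + 1) / Real.log 2 ^ 2 with hC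
  have hC0 : 0 < C := by rw [hC]; positivity
  refine ⟨C, hC0, fun t S hS ↦ ?_⟩
  set c : ℂ := (2 : ℂ) + (t + 1 / 2) * I with hc
  have hcre : c.re = 2 := by simp [hc]
  have hcim : c.im = t + 1 / 2 := by simp [hc]
  have hc1 : c ≠ 1 := by
    intro h; have := congrArg Complex.re h; rw [hcre] at this; norm_num at this
  -- the bound `M` on the circle of radius `5`
  set M : ℝ := max 1 (Cv * (8 + |t|) ^ A) with hM
  have hM1 : 1 ≤ M := le_max_left _ _
  have hM0 : 0 < M := by linarith
  have hGan : AnalyticOnNhd ℂ G (closedBall c |(5 : ℝ)|) := fun z _ ↦ hG.analyticAt z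
  have hGc : G c ≠ 0 := by
    rw [hGF c hc1]
    refine mul_ne_zero (pow_ne_zero _ (sub_ne_zero.mpr hc1)) fun h ↦ ?_
    have := hlow c (by rw [hcre])
    rw [h, norm_zero] at this
    linarith [Real.exp_pos (-M₂)]
  have hbound : ∀ z ∈ sphere c |(5 : ℝ)|, ‖G z‖ ≤ M := by
    intro z hz
    rw [mem_sphere, dist_eq_norm, abs_of_pos (by norm_num : (0 : ℝ) < 5)] at hz
    have hre : |(z - c).re| ≤ 5 := hz ▸ Complex.abs_re_le_norm (z - c)
    have him : |(z - c).im| ≤ 5 := hz ▸ Complex.abs_im_le_norm (z - c)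
    simp only [sub_re, hcre, sub_im, hcim] at hre him
    have h1 := hconv z (by linarith [(abs_le.mp hre).1]) (by linarith [(abs_le.mp hre).2])
    refine h1.trans (le_trans ?_ (le_max_right _ _))
    apply mul_le_mul_of_nonneg_left _ hCv.le
    apply Real.rpow_le_rpow (by linarith [abs_nonneg z.im]) _ hA
    have : |z.im| ≤ |t| + 6 := by
      have := (abs_le.mp him); rcases abs_le.mp (show |z.im - (t + 1 / 2)| ≤ 5 from him) with ⟨h1, h2⟩
      rw [abs_le]; constructor <;> linarith [le_abs_self t, neg_abs_le t]
    linarith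
  -- Jensen
  have hJ := AnalyticOnNhd.sum_divisor_le (f := G) (c := c) (r := 5 / 2) (R := 5)
    (by norm_num) (by norm_num) hM1 hGan hGc hbound
  -- the log term
  have hGcnorm : Real.exp (-M₂) ≤ ‖G c‖ := by
    rw [hGF c hc1, norm_mul, norm_pow]
    have h1 : 1 ≤ ‖c - 1‖ := by
      have := Complex.abs_re_le_norm (c - 1); simp [hcre] at this; norm_num at this; linarith
    have h2 := hlow c (by rw [hcre])
    calc Real.exp (-M₂) = 1 * Real.exp (-M₂) := (one_mul _).symm
      _ ≤ ‖c - 1‖ ^ D.polarOrder * ‖D.toFun c‖ :=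
          mul_le_mul (one_le_pow₀ h1) h2 (Real.exp_pos _).le (by positivity)
  have hlogM : Real.log M ≤ |Real.log Cv| + A * Real.log (8 + |t|) := by
    rcases eq_or_lt_of_le hM1 with h | h
    · rw [← h, Real.log_one]
      exact add_nonneg (abs_nonneg _) (mul_nonneg hA (Real.log_nonneg (by linarith [abs_nonneg t])))
    · have hMeq : M = Cv * (8 + |t|) ^ A := by
        rw [hM]; exact max_eq_right (by rw [hM] at h; exact (lt_max_iff.mp h).resolve_left (lt_irrefl 1) |>.le)
      rw [hMeq, Real.log_mul hCv.ne' (by positivity), Real.log_rpow (by positivity)]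
      linarith [le_abs_self (Real.log Cv)]
  have hlog8 : Real.log (8 + |t|) ≤ 4 * Real.log (2 + |t|) := by
    have h2t : (1 : ℝ) < 2 + |t| := by linarith [abs_nonneg t]
    have : 8 + |t| ≤ (2 + |t|) ^ 4 := by nlinarith [abs_nonneg t, sq_nonneg (|t|), sq_nonneg (2 + |t|)]
    calc Real.log (8 + |t|) ≤ Real.log ((2 + |t|) ^ 4) :=
          Real.log_le_log (by positivity) this
      _ = 4 * Real.log (2 + |t|) := by rw [Real.log_pow]; ring
  have hlogq : Real.log (M / ‖G c‖) ≤ |Real.log Cv| + 4 * A * Real.log (2 + |t|) + M₂ := by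
    have hGc0 : 0 < ‖G c‖ := norm_pos_iff.mpr hGc
    rw [Real.log_div hM0.ne' hGc0.ne']
    have : -M₂ ≤ Real.log ‖G c‖ := by
      have := Real.log_le_log (Real.exp_pos _) hGcnorm; rwa [Real.log_exp] at this
    nlinarith [hlogM, hlog8, hA]
  have hlog2' : Real.log ((5 : ℝ) / (5 / 2)) = Real.log 2 := by norm_num
  rw [hlog2'] at hJ
  -- from the finsum over the divisor to the sum over `S`
  set U := closedBall c |(5 / 2 : ℝ)| with hU
  have hGanU : AnalyticOnNhd ℂ G U := fun z hz ↦ hGan z (closedBall_subset_closedBall (by norm_num) hz)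
  have hmer : MeromorphicOn G U := hGanU.meromorphicOn
  set Dv := MeromorphicOn.divisor G U with hDv
  have hfin : (Function.support fun u ↦ (Dv u : ℝ)).Finite := by
    refine (Dv.finiteSupport (isCompact_closedBall _ _)).subset fun u hu ↦ ?_
    simpa using hu
  have hcast : ((∑ᶠ u, Dv u : ℤ) : ℝ) = ∑ᶠ u, (Dv u : ℝ) :=
    map_finsum (Int.castRingHom ℝ) (Dv.finiteSupport (isCompact_closedBall _ _))
  have hJ' : ∑ᶠ u, (Dv u : ℝ) ≤ (|Real.log Cv| + 4 * A * Real.log (2 + |t|) + M₂) / Real.log 2 := by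
    rw [← hcast]
    exact hJ.trans (div_le_div_of_nonneg_right hlogq hlog2.le)
  -- points of `S` are in `U` and carry `divisor = order`
  have hSU : ∀ ρ ∈ S, ρ ∈ U := by
    intro ρ hρ
    obtain ⟨h0, h1, h2, h3⟩ := hS ρ hρ
    rw [hU, mem_closedBall, dist_eq_norm, abs_of_pos (by norm_num : (0 : ℝ) < 5 / 2)]
    have hre : |(ρ - c).re| ≤ 2 := by simp [hcre]; rw [abs_le]; constructor <;> linarith
    have him : |(ρ - c).im| ≤ 1 / 2 := by simp [hcim]; rw [abs_le]; constructor <;> linarith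
    calc ‖ρ - c‖ ≤ |(ρ - c).re| + |(ρ - c).im| := Complex.norm_le_abs_re_add_abs_im _
      _ ≤ 5 / 2 := by linarith
  have hSord : ∀ ρ ∈ S, ((meromorphicOrderAt D.completed ρ).untop₀ : ℝ) = (Dv ρ : ℝ) := by
    intro ρ hρ
    obtain ⟨h0, h1, -, -⟩ := hS ρ hρ
    rw [hDv, MeromorphicOn.divisor_apply hmer (hSU ρ hρ),
      D.meromorphicOrderAt_completed_eq_of_entire hG hGF h0 h1]
  rw [Finset.sum_congr rfl hSord]
  have hnn : ∀ u, (0 : ℝ) ≤ (Dv u : ℝ) := fun u ↦ by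
    have h0 : (0 : ℤ) ≤ Dv u := by simpa using hGanU.divisor_nonneg u
    exact_mod_cast h0
  calc ∑ ρ ∈ S, (Dv ρ : ℝ) = ∑ ρ ∈ S.filter (fun ρ ↦ (Dv ρ : ℝ) ≠ 0), (Dv ρ : ℝ) :=
        (Finset.sum_filter_ne_zero S).symm
    _ ≤ ∑ u ∈ hfin.toFinset, (Dv u : ℝ) := by
        refine Finset.sum_le_sum_of_subset_of_nonneg (fun u hu ↦ ?_) fun u _ _ ↦ hnn u
        rw [Finset.mem_filter] at hu
        rw [Set.Finite.mem_toFinset, Function.mem_support]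
        exact hu.2
    _ = ∑ᶠ u, (Dv u : ℝ) := (finsum_eq_sum_of_support_subset _ (s := hfin.toFinset) (by simp)).symm
    _ ≤ (|Real.log Cv| + 4 * A * Real.log (2 + |t|) + M₂) / Real.log 2 := hJ'
    _ ≤ C * Real.log (2 + |t|) := by
        have hl2 : Real.log 2 ≤ Real.log (2 + |t|) := Real.log_le_log two_pos (by linarith [abs_nonneg t])
        have hℓ : 1 ≤ Real.log (2 + |t|) / Real.log 2 := by rwa [le_div_iff₀ hlog2, one_mul]
        have hℓ0 : 0 ≤ Real.log (2 + |t|) / Real.log 2 := by linarith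
        have hlt1 : Real.log 2 ≤ 1 := by have := Real.log_two_lt_d9; linarith
        have e1 : |Real.log Cv| ≤ |Real.log Cv| * (Real.log (2 + |t|) / Real.log 2) :=
          le_mul_of_one_le_right (abs_nonneg _) hℓ
        have e2 : M₂ ≤ M₂ * (Real.log (2 + |t|) / Real.log 2) := le_mul_of_one_le_right hM₂ hℓ
        have e3 : 4 * A * Real.log (2 + |t|) ≤ 4 * A * (Real.log (2 + |t|) / Real.log 2) := by
          have : Real.log (2 + |t|) ≤ Real.log (2 + |t|) / Real.log 2 := by
            rw [le_div_iff₀ hlog2]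
            have : 0 ≤ Real.log (2 + |t|) := by linarith
            nlinarith
          exact mul_le_mul_of_nonneg_left this (by positivity)
        have hX : |Real.log Cv| + 4 * A * Real.log (2 + |t|) + M₂ ≤
            (|Real.log Cv| + 4 * A + M₂ + 1) * (Real.log (2 + |t|) / Real.log 2) := by nlinarith
        calc (|Real.log Cv| + 4 * A * Real.log (2 + |t|) + M₂) / Real.log 2
            ≤ (|Real.log Cv| + 4 * A + M₂ + 1) * (Real.log (2 + |t|) / Real.log 2) / Real.log 2 :=
              div_le_div_of_nonneg_right hX hlog2.le
          _ = C * Real.log (2 + |t|) := by rw [hC]; field_simp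

end SelbergDatum

namespace SelbergDatum

variable (D : SelbergDatum)

/-- **The gamma-factor part of `Φ'/Φ` is `O(log t)` near the critical line**: there is `C` with
`‖∑ⱼ λⱼ ψ(λⱼ z + μⱼ)‖ ≤ C log(2 + |im z|) + C` for `1/4 ≤ re z ≤ 3/4` (Stirling-type bound
`ψ(w) = O(log |w|)` on `re w > 0`, `|im w| ≥ 1/2`, plus continuity on a compact set). [folklore] -/
theorem exists_norm_sum_digamma_le :
    ∃ C : ℝ, 0 ≤ C ∧ ∀ z : ℂ, 1 / 4 ≤ z.re → z.re ≤ 3 / 4 →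
      ‖∑ j, (D.lam j : ℂ) * digamma (D.lam j * z + D.mu j)‖ ≤ C * Real.log (2 + |z.im|) + C := by
  -- a bound for each gamma factor
  have hj : ∀ j, ∃ Cj : ℝ, 0 ≤ Cj ∧ ∀ z : ℂ, 1 / 4 ≤ z.re → z.re ≤ 3 / 4 →
      ‖digamma (D.lam j * z + D.mu j)‖ ≤ Cj + Real.log (2 + |z.im|) := by
    intro j
    have hl := D.lam_pos j
    have hμ := D.mu_re_nonneg j
    -- the compact set of small imaginary parts
    set K : Set ℂ := (fun p : ℝ × ℝ ↦ (p.1 : ℂ) + p.2 * I) ''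
      (Icc (D.lam j / 4 + (D.mu j).re) (3 * D.lam j / 4 + (D.mu j).re) ×ˢ Icc (-(1 / 2 : ℝ)) (1 / 2)) with hK
    have hKc : IsCompact K := (isCompact_Icc.prod isCompact_Icc).image (by fun_prop)
    have hKsub : K ⊆ {w : ℂ | 0 < w.re} := by
      rintro _ ⟨⟨x, y⟩, ⟨hx, -⟩, rfl⟩
      simp only [Set.mem_setOf_eq, add_re, ofReal_re, mul_re, I_re, mul_zero, ofReal_im, I_im,
        mul_one, sub_self, add_zero]
      linarith [hx.1]
    obtain ⟨M, hM⟩ := hKc.exists_bound_of_continuousOn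
      (Literature.Analysis.SpecialFunctions.Complex.continuousOn_digamma.mono hKsub)
    have hlog1 : 0 ≤ Real.log (1 + D.lam j + ‖D.mu j‖) :=
      Real.log_nonneg (by linarith [norm_nonneg (D.mu j)])
    refine ⟨|M| + 8 + Real.log (1 + D.lam j + ‖D.mu j‖), by positivity, fun z hz1 hz2 ↦ ?_⟩
    set w : ℂ := D.lam j * z + D.mu j with hw
    have hwre : w.re = D.lam j * z.re + (D.mu j).re := by rw [hw, re_lam_mul_add]
    have hwim : w.im = D.lam j * z.im + (D.mu j).im := by simp [hw, Complex.mul_im]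
    have hwre0 : 0 < w.re := by rw [hwre]; nlinarith
    have hlog0 : 0 ≤ Real.log (2 + |z.im|) := Real.log_nonneg (by linarith [abs_nonneg z.im])
    rcases le_or_gt (1 / 2 : ℝ) |w.im| with hbig | hsmall
    · have h := Literature.Analysis.SpecialFunctions.Complex.norm_digamma_le_log hwre0 hbig
      have hnw : ‖w‖ ≤ D.lam j * (1 + |z.im|) + ‖D.mu j‖ := by
        rw [hw]
        refine (norm_add_le _ _).trans (add_le_add ?_ le_rfl)
        rw [norm_mul, Complex.norm_real, Real.norm_of_nonneg hl.le]
        refine mul_le_mul_of_nonneg_left ?_ hl.le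
        calc ‖z‖ ≤ |z.re| + |z.im| := Complex.norm_le_abs_re_add_abs_im z
          _ ≤ 1 + |z.im| := by rw [abs_of_nonneg (by linarith)]; linarith
      have hprod : 1 + ‖w‖ ≤ (1 + D.lam j + ‖D.mu j‖) * (2 + |z.im|) := by
        nlinarith [abs_nonneg z.im, norm_nonneg (D.mu j)]
      have hlog : Real.log (1 + ‖w‖) ≤ Real.log (1 + D.lam j + ‖D.mu j‖) + Real.log (2 + |z.im|) := by
        rw [← Real.log_mul (by linarith [norm_nonneg (D.mu j)]) (by linarith [abs_nonneg z.im])]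
        exact Real.log_le_log (by linarith [norm_nonneg w]) hprod
      linarith [abs_nonneg M]
    · have hmem : w ∈ K := by
        refine ⟨⟨w.re, w.im⟩, ⟨⟨?_, ?_⟩, ?_⟩, ?_⟩
        · rw [hwre]; nlinarith
        · rw [hwre]; nlinarith
        · exact ⟨by linarith [(abs_lt.mp hsmall).1], by linarith [(abs_lt.mp hsmall).2]⟩
        · exact Complex.ext (by simp) (by simp)
      have h := hM w hmem
      linarith [le_abs_self M]
  choose Cj hCj0 hCj using hj
  refine ⟨∑ j, D.lam j * (Cj j + 1), Finset.sum_nonneg fun j _ ↦ by nlinarith [D.lam_pos j, hCj0 j],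
    fun z hz1 hz2 ↦ ?_⟩
  have hlog0 : 0 ≤ Real.log (2 + |z.im|) := Real.log_nonneg (by linarith [abs_nonneg z.im])
  calc ‖∑ j, (D.lam j : ℂ) * digamma (D.lam j * z + D.mu j)‖
      ≤ ∑ j, ‖(D.lam j : ℂ) * digamma (D.lam j * z + D.mu j)‖ := norm_sum_le _ _
    _ ≤ ∑ j, D.lam j * (Cj j + Real.log (2 + |z.im|)) := by
        refine Finset.sum_le_sum fun j _ ↦ ?_
        rw [norm_mul, Complex.norm_real, Real.norm_of_nonneg (D.lam_pos j).le]
        exact mul_le_mul_of_nonneg_left (hCj j z hz1 hz2) (D.lam_pos j).le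
    _ ≤ (∑ j, D.lam j * (Cj j + 1)) * Real.log (2 + |z.im|) + ∑ j, D.lam j * (Cj j + 1) := by
        rw [Finset.sum_mul, ← Finset.sum_add_distrib]
        refine Finset.sum_le_sum fun j _ ↦ ?_
        nlinarith [mul_nonneg (mul_nonneg (D.lam_pos j).le (hCj0 j)) hlog0, D.lam_pos j, hCj0 j, hlog0]

end SelbergDatum

/-- **Avoiding finitely many ordinates.** For a finite set `Z ⊆ ℂ` and `t ∈ ℝ` there is a height
`T' ∈ [t, t + 1]` at distance `≥ 1/(2(#Z + 1))` from the ordinate of every point of `Z` (the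
excluded intervals have total length `≤ #Z/(#Z+1) < 1`). [folklore] -/
theorem Soundararajan2004.exists_height_far_from (Z : Finset ℂ) (t : ℝ) :
    ∃ T' ∈ Icc t (t + 1), ∀ u ∈ Z, 1 / (2 * ((Z.card : ℝ) + 1)) ≤ |T' - u.im| := by
  set δ : ℝ := 1 / (2 * ((Z.card : ℝ) + 1)) with hδ
  have hδ0 : 0 < δ := by rw [hδ]; positivity
  by_contra hcon
  push Not at hcon
  -- every point of `[t, t+1]` is within `δ` of some ordinate
  have hcover : Icc t (t + 1) ⊆ ⋃ u ∈ Z, Ioo (u.im - δ) (u.im + δ) := by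
    intro T hT
    obtain ⟨u, hu, hlt⟩ := hcon T hT
    refine Set.mem_iUnion₂.mpr ⟨u, hu, ?_⟩
    rw [abs_lt] at hlt
    exact ⟨by linarith [hlt.1], by linarith [hlt.2]⟩
  have h1 : MeasureTheory.volume (Icc t (t + 1)) = 1 := by
    rw [Real.volume_Icc]; simp
  have h2 : MeasureTheory.volume (⋃ u ∈ Z, Ioo (u.im - δ) (u.im + δ)) ≤
      ∑ u ∈ Z, MeasureTheory.volume (Ioo (u.im - δ) (u.im + δ)) :=
    MeasureTheory.measure_biUnion_finset_le Z _
  have h3 : ∑ u ∈ Z, MeasureTheory.volume (Ioo (u.im - δ) (u.im + δ)) = Z.card * ENNReal.ofReal (2 * δ) := by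
    simp only [Real.volume_Ioo, show ∀ u : ℂ, u.im + δ - (u.im - δ) = 2 * δ from fun u ↦ by ring,
      Finset.sum_const, nsmul_eq_mul]
  have h4 : (Z.card : ENNReal) * ENNReal.ofReal (2 * δ) < 1 := by
    rw [← ENNReal.ofReal_natCast, ← ENNReal.ofReal_mul (Nat.cast_nonneg _), ← ENNReal.ofReal_one]
    refine (ENNReal.ofReal_lt_ofReal_iff_of_nonneg (by positivity)).mpr ?_
    rw [hδ]
    have hc : (0 : ℝ) ≤ Z.card := Nat.cast_nonneg _
    rw [show (Z.card : ℝ) * (2 * (1 / (2 * ((Z.card : ℝ) + 1)))) = Z.card / (Z.card + 1) by field_simp,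
      div_lt_one (by linarith)]
    linarith
  have := (MeasureTheory.measure_mono hcover).trans h2
  rw [h1, h3] at this
  exact absurd (this.trans_lt h4) (lt_irrefl 1)

namespace SelbergDatum

open Literature.Analysis.Complex

variable (D : SelbergDatum)

set_option maxHeartbeats 1600000 in
/-- **`Φ'/Φ` near the critical line, away from the zeros** (Landau's lemma, Titchmarsh §3.9 Lemma α,
in the tree's form `Literature.Analysis.Complex.norm_logDeriv_sub_sum_le`): there is `C = C(F) > 0`
such that for every real `t` there are a finite set `Z` (the zeros of `(s−1)^m F(s)` in the disc of
radius `3` about `2 + i(t + 1/2)`) and multiplicities `m(u) ≥ 1`, with `#Z ≤ ∑ m(u) ≤ C log(2+|t|)`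
(Jensen), such that at every point `z` of the window `1/4 ≤ re z ≤ 3/4`, `t ≤ im z ≤ t+1` not in
`Z`: `Φ(z) ≠ 0` and `‖Φ'/Φ(z)‖ ≤ C log(2 + |t|) + ∑_{u ∈ Z} m(u)/‖z − u‖`. (The source absorbs this in
"`#{ρ_F : |im ρ_F| ≤ T} = … + O_F(log T)`" and the standard partial-fraction estimate for `F'/F`.)
[cite: Soundararajan2002, p. 2] -/
theorem exists_logDeriv_completed_le :
    ∃ C : ℝ, 0 < C ∧ ∀ t : ℝ, ∃ (Z : Finset ℂ) (mlt : ℂ → ℝ), (∀ u, 0 ≤ mlt u) ∧ (∀ u ∈ Z, 1 ≤ mlt u) ∧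
      (∑ u ∈ Z, mlt u ≤ C * Real.log (2 + |t|)) ∧
      ∀ z : ℂ, 1 / 4 ≤ z.re → z.re ≤ 3 / 4 → t ≤ z.im → z.im ≤ t + 1 → z ∉ Z →
        D.completed z ≠ 0 ∧
          ‖logDeriv D.completed z‖ ≤ C * Real.log (2 + |t|) + ∑ u ∈ Z, mlt u / ‖z - u‖ := by
  classical
  obtain ⟨G, hG, hGF⟩ := D.differentiable
  obtain ⟨Cv, A, hCv, hA, hconv⟩ := D.exists_norm_entire_le (-5) 9 hG hGF
  obtain ⟨M₂, hM₂, hlow⟩ := D.exists_exp_neg_le_norm_toFun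
  obtain ⟨Cψ, hCψ, hψ⟩ := D.exists_norm_sum_digamma_le
  have hlog2 : 0 < Real.log 2 := Real.log_pos one_lt_two
  have hlog7 : 0 < Real.log 7 := Real.log_pos (by norm_num)
  -- a generous constant
  set K : ℝ := |Real.log Cv| + 4 * A + M₂ + 1 with hK
  have hK0 : 0 < K := by rw [hK]; positivity
  set C : ℝ := (K / Real.log 2 ^ 2) * (1 + 20 * Real.log 7) + (20 * K + 20 + ‖Complex.log D.Q‖ + 3 * Cψ +
      4 * D.polarOrder) / Real.log 2 with hC
  have hC0 : 0 < C := by rw [hC]; positivity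
  refine ⟨C, hC0, fun t ↦ ?_⟩
  set c : ℂ := (2 : ℂ) + (t + 1 / 2) * I with hc
  have hcre : c.re = 2 := by simp [hc]
  have hcim : c.im = t + 1 / 2 := by simp [hc]
  have hc1 : c ≠ 1 := by
    intro h; have := congrArg Complex.re h; rw [hcre] at this; norm_num at this
  have hGc : G c ≠ 0 := by
    rw [hGF c hc1]
    refine mul_ne_zero (pow_ne_zero _ (sub_ne_zero.mpr hc1)) fun h ↦ ?_
    have := hlow c (by rw [hcre])
    rw [h, norm_zero] at this
    linarith [Real.exp_pos (-M₂)]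
  have hGcnorm : Real.exp (-M₂) ≤ ‖G c‖ := by
    rw [hGF c hc1, norm_mul, norm_pow]
    have h1 : 1 ≤ ‖c - 1‖ := by
      have := Complex.abs_re_le_norm (c - 1); simp [hcre] at this; norm_num at this; linarith
    calc Real.exp (-M₂) = 1 * Real.exp (-M₂) := (one_mul _).symm
      _ ≤ ‖c - 1‖ ^ D.polarOrder * ‖D.toFun c‖ :=
          mul_le_mul (one_le_pow₀ h1) (hlow c (by rw [hcre])) (Real.exp_pos _).le (by positivity)
  -- `‖G‖ ≤ M` on `|z - c| ≤ 6`, `M = max 1 (Cv (8 + |t|)^A)`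
  set M : ℝ := max 1 (Cv * (8 + |t|) ^ A) with hM
  have hM1 : 1 ≤ M := le_max_left _ _
  have hM0 : 0 < M := by linarith
  have hGbound : ∀ z ∈ closedBall c (6 : ℝ), ‖G z‖ ≤ M := by
    intro z hz
    rw [mem_closedBall, dist_eq_norm] at hz
    have hre : |(z - c).re| ≤ 6 := (Complex.abs_re_le_norm (z - c)).trans hz
    have him : |(z - c).im| ≤ 6 := (Complex.abs_im_le_norm (z - c)).trans hz
    simp only [sub_re, hcre, sub_im, hcim] at hre him
    have h1 := hconv z (by linarith [(abs_le.mp hre).1]) (by linarith [(abs_le.mp hre).2])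
    refine h1.trans (le_trans ?_ (le_max_right _ _))
    apply mul_le_mul_of_nonneg_left _ hCv.le
    apply Real.rpow_le_rpow (by linarith [abs_nonneg z.im]) _ hA
    have : |z.im| ≤ |t| + 7 := by
      rcases abs_le.mp him with ⟨h1, h2⟩
      rw [abs_le]; constructor <;> linarith [le_abs_self t, neg_abs_le t]
    linarith
  have hlog8 : Real.log (8 + |t|) ≤ 4 * Real.log (2 + |t|) := by
    have : 8 + |t| ≤ (2 + |t|) ^ 4 := by nlinarith [abs_nonneg t, sq_nonneg (|t|), sq_nonneg (2 + |t|)]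
    calc Real.log (8 + |t|) ≤ Real.log ((2 + |t|) ^ 4) := Real.log_le_log (by positivity) this
      _ = 4 * Real.log (2 + |t|) := by rw [Real.log_pow]; ring
  have hlogt0 : 0 ≤ Real.log (2 + |t|) := Real.log_nonneg (by linarith [abs_nonneg t])
  have hl2 : Real.log 2 ≤ Real.log (2 + |t|) := Real.log_le_log two_pos (by linarith [abs_nonneg t])
  have hlogq : Real.log (M / ‖G c‖) ≤ K * (Real.log (2 + |t|) / Real.log 2) := by
    have hGc0 : 0 < ‖G c‖ := norm_pos_iff.mpr hGc
    have hlogM : Real.log M ≤ |Real.log Cv| + A * Real.log (8 + |t|) := by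
      rcases eq_or_lt_of_le hM1 with h | h
      · rw [← h, Real.log_one]
        exact add_nonneg (abs_nonneg _) (mul_nonneg hA (Real.log_nonneg (by linarith [abs_nonneg t])))
      · have hMeq : M = Cv * (8 + |t|) ^ A :=
          max_eq_right ((lt_max_iff.mp h).resolve_left (lt_irrefl 1)).le
        rw [hMeq, Real.log_mul hCv.ne' (by positivity), Real.log_rpow (by positivity)]
        linarith [le_abs_self (Real.log Cv)]
    rw [Real.log_div hM0.ne' hGc0.ne']
    have : -M₂ ≤ Real.log ‖G c‖ := by
      have := Real.log_le_log (Real.exp_pos _) hGcnorm; rwa [Real.log_exp] at this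
    have hℓ : 1 ≤ Real.log (2 + |t|) / Real.log 2 := by rwa [le_div_iff₀ hlog2, one_mul]
    have e3 : 4 * A * Real.log (2 + |t|) ≤ 4 * A * (Real.log (2 + |t|) / Real.log 2) := by
      have hlt1 : Real.log 2 ≤ 1 := by have := Real.log_two_lt_d9; linarith
      have : Real.log (2 + |t|) ≤ Real.log (2 + |t|) / Real.log 2 := by
        rw [le_div_iff₀ hlog2]; nlinarith
      exact mul_le_mul_of_nonneg_left this (by positivity)
    have e1 := le_mul_of_one_le_right (abs_nonneg (Real.log Cv)) hℓ
    have e2 := le_mul_of_one_le_right hM₂ hℓ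
    have e5 : A * Real.log (8 + |t|) ≤ A * (4 * Real.log (2 + |t|)) := mul_le_mul_of_nonneg_left hlog8 hA
    have hℓ0 : 0 ≤ Real.log (2 + |t|) / Real.log 2 := by linarith
    have hexp : K * (Real.log (2 + |t|) / Real.log 2) =
        |Real.log Cv| * (Real.log (2 + |t|) / Real.log 2) + 4 * A * (Real.log (2 + |t|) / Real.log 2) +
          M₂ * (Real.log (2 + |t|) / Real.log 2) + (Real.log (2 + |t|) / Real.log 2) := by rw [hK]; ring
    rw [hexp]
    linarith
  -- the zero set: support of the divisor on `|z - c| ≤ 3`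
  set U := closedBall c (3 : ℝ) with hU
  have hGan : ∀ r : ℝ, AnalyticOnNhd ℂ G (closedBall c r) := fun r z _ ↦ hG.analyticAt z
  have hGanU : AnalyticOnNhd ℂ G U := hGan 3
  have hmer : MeromorphicOn G U := hGanU.meromorphicOn
  set Dv := MeromorphicOn.divisor G U with hDv
  have hfinS : Dv.support.Finite := Dv.finiteSupport (isCompact_closedBall c 3)
  set Z : Finset ℂ := hfinS.toFinset with hZ
  have hnn : ∀ u, (0 : ℝ) ≤ (Dv u : ℝ) := fun u ↦ by
    have h0 : (0 : ℤ) ≤ Dv u := by simpa using hGanU.divisor_nonneg u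
    exact_mod_cast h0
  have hZ1 : ∀ u ∈ Z, (1 : ℝ) ≤ (Dv u : ℝ) := by
    intro u hu
    rw [hZ, Set.Finite.mem_toFinset, Function.mem_support] at hu
    have h0 : (0 : ℤ) ≤ Dv u := by simpa using hGanU.divisor_nonneg u
    have : (1 : ℤ) ≤ Dv u := by omega
    exact_mod_cast this
  -- Jensen: `∑ Dv ≤ K/log 2² · log(2+|t|)`
  have hsumZ : ∑ u ∈ Z, (Dv u : ℝ) ≤ K / Real.log 2 ^ 2 * Real.log (2 + |t|) := by
    have hJ := AnalyticOnNhd.sum_divisor_le (f := G) (c := c) (r := 3) (R := 6)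
      (by norm_num) (by norm_num) hM1 (by simpa using hGan |(6 : ℝ)|) hGc
      (fun z hz ↦ hGbound z (by simpa [abs_of_pos (by norm_num : (0:ℝ) < 6)] using sphere_subset_closedBall hz))
    have hcast : ((∑ᶠ u, Dv u : ℤ) : ℝ) = ∑ᶠ u, (Dv u : ℝ) := by
      have := map_finsum (Int.castRingHom ℝ) hfinS
      simpa [abs_of_pos (by norm_num : (0:ℝ) < 3)] using this
    have hfin' : (Function.support fun u ↦ (Dv u : ℝ)).Finite := hfinS.subset fun u hu ↦ by simpa using hu
    have heq : ∑ᶠ u, (Dv u : ℝ) = ∑ u ∈ Z, (Dv u : ℝ) :=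
      finsum_eq_sum_of_support_subset _ (s := Z) (fun u hu ↦ by
        rw [hZ, Set.Finite.coe_toFinset]; simpa using hu)
    have h62 : Real.log ((6 : ℝ) / 3) = Real.log 2 := by norm_num
    rw [← heq, ← hcast]
    have hJ' : ((∑ᶠ u, (divisor G (closedBall c |(3 : ℝ)|)) u : ℤ) : ℝ) ≤ K * (Real.log (2 + |t|) / Real.log 2) / Real.log 2 := by
      rw [h62] at hJ
      exact hJ.trans (div_le_div_of_nonneg_right hlogq hlog2.le)
    have : (∑ᶠ u, (divisor G (closedBall c |(3 : ℝ)|)) u : ℤ) = ∑ᶠ u, Dv u := by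
      rw [hDv, hU, abs_of_pos (by norm_num : (0:ℝ) < 3)]
    rw [this] at hJ'
    refine hJ'.trans_eq ?_
    field_simp
  refine ⟨Z, fun u ↦ (Dv u : ℝ), hnn, hZ1, hsumZ.trans ?_, fun z hz1 hz2 hz3 hz4 hzZ ↦ ?_⟩
  · apply mul_le_mul_of_nonneg_right _ hlogt0
    rw [hC]
    have : 0 ≤ (20 * K + 20 + ‖Complex.log D.Q‖ + 3 * Cψ + 4 * D.polarOrder) / Real.log 2 := by positivity
    nlinarith [hlog7, div_nonneg hK0.le (sq_nonneg (Real.log 2))]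
  -- the point `z`
  have hzc : ‖z - c‖ ≤ 2 := by
    have hre : |(z - c).re| ≤ 7 / 4 := by simp [hcre]; rw [abs_le]; constructor <;> linarith
    have him : |(z - c).im| ≤ 1 / 2 := by simp [hcim]; rw [abs_le]; constructor <;> linarith
    have hsq : ‖z - c‖ ^ 2 ≤ 4 := by
      rw [Complex.sq_norm, Complex.normSq_apply]
      nlinarith [abs_le.mp hre, abs_le.mp him, sq_abs (z - c).re, sq_abs (z - c).im]
    nlinarith [norm_nonneg (z - c)]
  have hzU : z ∈ U := by rw [hU, mem_closedBall, dist_eq_norm]; linarith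
  have hz1ne : z ≠ 1 := by intro h; rw [h] at hz2; norm_num at hz2
  -- `G z ≠ 0` since the divisor vanishes at `z`
  have hGz : G z ≠ 0 := by
    have hdz : Dv z = 0 := by
      by_contra h
      exact hzZ (by rw [hZ, Set.Finite.mem_toFinset, Function.mem_support]; exact h)
    rw [hDv, MeromorphicOn.divisor_apply hmer hzU, (hGanU z hzU).meromorphicOrderAt_eq] at hdz
    have hne : analyticOrderAt G z ≠ ⊤ := by
      intro htop
      have := hGanU.eqOn_zero_of_preconnected_of_eventuallyEq_zero (convex_closedBall c 3).isPreconnected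
        hzU (analyticOrderAt_eq_top.mp htop) (mem_closedBall_self (by norm_num))
      exact hGc this
    obtain ⟨n, hn⟩ := ENat.ne_top_iff_exists.mp hne
    rw [← hn] at hdz
    simp at hdz
    have h0 : analyticOrderAt G z = 0 := by rw [← hn, hdz]; rfl
    exact (hGanU z hzU).analyticOrderAt_eq_zero.mp h0
  have hFz : D.toFun z ≠ 0 := by
    have := hGF z hz1ne
    intro h0; rw [h0, mul_zero] at this; exact hGz this
  have hz0 : 0 < z.re := by linarith
  have hΦz : D.completed z ≠ 0 := by
    rw [D.completed_eq_gammaFactor_mul]; exact mul_ne_zero (D.gammaFactor_ne_zero hz0) hFz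
  refine ⟨hΦz, ?_⟩
  -- Landau's lemma for `G` on the radii `2 < 5/2 < 3 < 7/2`
  have hB : ∀ w ∈ closedBall c (7 / 2 : ℝ), ‖G w‖ ≤ M := fun w hw ↦
    hGbound w (closedBall_subset_closedBall (by norm_num) hw)
  have hL := norm_logDeriv_sub_sum_le (f := G) (c := c) (r := 2) (r₁ := 5 / 2) (R₂ := 3) (R := 7 / 2)
    (by norm_num) (by norm_num) (by norm_num) (by norm_num) (hGan (7 / 2)) hGc hB
    (by rw [mem_closedBall, dist_eq_norm]; exact hzc) hGz
  -- identify the finite set and the divisor of the lemma with `Z`, `Dv`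
  have hZeq : ((divisor G (closedBall c 3)).finiteSupport (isCompact_closedBall c 3)).toFinset = Z := by
    rw [hZ]
  rw [hZeq] at hL
  change ‖logDeriv G z - ∑ u ∈ Z, (Dv u : ℂ) / (z - u)‖ ≤
    2 * (5 / 2) / ((3 - 5 / 2) * (5 / 2 - 2)) * (Real.log (M / ‖G c‖) + (∑ u ∈ Z, (Dv u : ℝ)) * Real.log (7 / 2 / (7 / 2 - 3)) + 1) at hL
  have h72 : Real.log ((7 : ℝ) / 2 / (7 / 2 - 3)) = Real.log 7 := by norm_num
  rw [h72] at hL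
  norm_num at hL
  -- `‖logDeriv G z‖`
  have hsumnorm : ‖∑ u ∈ Z, (Dv u : ℂ) / (z - u)‖ ≤ ∑ u ∈ Z, (Dv u : ℝ) / ‖z - u‖ := by
    refine (norm_sum_le _ _).trans (Finset.sum_le_sum fun u _ ↦ ?_)
    rw [norm_div, Complex.norm_intCast, abs_of_nonneg (hnn u)]
  have hlogG : ‖logDeriv G z‖ ≤ 20 * (Real.log (M / ‖G c‖) + (∑ u ∈ Z, (Dv u : ℝ)) * Real.log 7 + 1) +
      ∑ u ∈ Z, (Dv u : ℝ) / ‖z - u‖ := by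
    have := norm_sub_le_norm_sub_add_norm_sub (logDeriv G z) (∑ u ∈ Z, (Dv u : ℂ) / (z - u)) 0
    simp only [sub_zero] at this
    linarith
  -- `logDeriv Φ = log Q + Σ λψ + logDeriv G − m/(z-1)`
  have hdecomp : logDeriv D.completed z = Complex.log D.Q + ∑ j, (D.lam j : ℂ) * digamma (D.lam j * z + D.mu j) +
      (logDeriv G z - D.polarOrder / (z - 1)) := by
    rw [D.logDeriv_completed hz0 hz1ne hFz]
    congr 1
    have hev : G =ᶠ[𝓝 z] fun w ↦ (w - 1) ^ D.polarOrder * D.toFun w := by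
      filter_upwards [isOpen_ne.mem_nhds hz1ne] with w hw; exact hGF w hw
    have hGd : logDeriv G z = logDeriv (fun w ↦ (w - 1) ^ D.polarOrder * D.toFun w) z := by
      rw [logDeriv_apply, logDeriv_apply, hev.deriv_eq, hev.eq_of_nhds]
    rw [hGd, logDeriv_mul (f := fun w ↦ (w - 1) ^ D.polarOrder) (g := D.toFun) z
      (pow_ne_zero _ (sub_ne_zero.mpr hz1ne)) hFz (by fun_prop) (D.differentiableAt_toFun hz1ne)]
    have hp : logDeriv (fun w : ℂ ↦ (w - 1) ^ D.polarOrder) z = D.polarOrder / (z - 1) := by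
      rw [show (fun w : ℂ ↦ (w - 1) ^ D.polarOrder) = fun w ↦ ((fun w : ℂ ↦ w - 1) w) ^ D.polarOrder by rfl,
        logDeriv_fun_pow (by fun_prop), logDeriv_apply]
      simp
      ring
    rw [hp]; ring
  have hm : ‖(D.polarOrder : ℂ) / (z - 1)‖ ≤ 4 * D.polarOrder := by
    rw [norm_div, Complex.norm_natCast]
    have h14 : 1 / 4 ≤ ‖z - 1‖ := by
      have := Complex.abs_re_le_norm (z - 1); simp at this
      have : 1 / 4 ≤ |z.re - 1| := by rw [abs_of_nonpos (by linarith)]; linarith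
      linarith
    rw [div_le_iff₀ (by linarith)]
    nlinarith
  have hψz := hψ z hz1 hz2
  -- `log(2+|z.im|) ≤ log(2+|t|) + log 2`-type: `2 + |z.im| ≤ 2 (2 + |t|)`
  have hlogz : Real.log (2 + |z.im|) ≤ 2 * Real.log (2 + |t|) := by
    have : 2 + |z.im| ≤ (2 + |t|) ^ 2 := by
      have : |z.im| ≤ |t| + 1 := by rw [abs_le]; constructor <;> linarith [le_abs_self t, neg_abs_le t]
      nlinarith [abs_nonneg t]
    calc Real.log (2 + |z.im|) ≤ Real.log ((2 + |t|) ^ 2) := Real.log_le_log (by linarith [abs_nonneg z.im]) this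
      _ = 2 * Real.log (2 + |t|) := by rw [Real.log_pow]; ring
  rw [hdecomp]
  calc ‖Complex.log D.Q + ∑ j, (D.lam j : ℂ) * digamma (D.lam j * z + D.mu j) +
        (logDeriv G z - D.polarOrder / (z - 1))‖
      ≤ ‖Complex.log D.Q‖ + ‖∑ j, (D.lam j : ℂ) * digamma (D.lam j * z + D.mu j)‖ +
        (‖logDeriv G z‖ + ‖(D.polarOrder : ℂ) / (z - 1)‖) := by
        refine (norm_add_le _ _).trans (add_le_add (norm_add_le _ _) (norm_sub_le _ _))
    _ ≤ C * Real.log (2 + |t|) + ∑ u ∈ Z, (Dv u : ℝ) / ‖z - u‖ := by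
        set X : ℝ := Real.log (2 + |t|) with hX
        set ℓ : ℝ := X / Real.log 2 with hℓdef
        set S : ℝ := ∑ u ∈ Z, (Dv u : ℝ) / ‖z - u‖ with hSdef
        have hℓ : 1 ≤ ℓ := by rw [hℓdef, le_div_iff₀ hlog2, one_mul]; exact hl2
        have hℓ0 : 0 ≤ ℓ := by linarith
        have hXℓ : X ≤ ℓ := by
          have hlt1 : Real.log 2 ≤ 1 := by have := Real.log_two_lt_d9; linarith
          rw [hℓdef, le_div_iff₀ hlog2]; nlinarith
        have hS0 : 0 ≤ S := Finset.sum_nonneg fun u _ ↦ div_nonneg (hnn u) (norm_nonneg _)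
        have hsZ' : ∑ u ∈ Z, (Dv u : ℝ) ≤ K * ℓ / Real.log 2 := by
          refine hsumZ.trans_eq ?_; rw [hℓdef]; field_simp
        have hKℓ : 0 ≤ K * ℓ / Real.log 2 := by positivity
        have hG' : ‖logDeriv G z‖ ≤ 20 * (K * ℓ) + 20 * Real.log 7 * (K * ℓ / Real.log 2) + 20 + S := by
          have h1 : (∑ u ∈ Z, (Dv u : ℝ)) * Real.log 7 ≤ (K * ℓ / Real.log 2) * Real.log 7 :=
            mul_le_mul_of_nonneg_right hsZ' hlog7.le
          linarith [hlogG, hlogq]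
        have hψ' : ‖∑ j, (D.lam j : ℂ) * digamma (D.lam j * z + D.mu j)‖ ≤ 3 * Cψ * ℓ := by
          have h1 : Cψ * Real.log (2 + |z.im|) ≤ Cψ * (2 * X) := mul_le_mul_of_nonneg_left hlogz hCψ
          have h2 : Cψ * X ≤ Cψ * ℓ := mul_le_mul_of_nonneg_left hXℓ hCψ
          have h3 : Cψ ≤ Cψ * ℓ := le_mul_of_one_le_right hCψ hℓ
          linarith [hψz]
        have hm' : ‖(D.polarOrder : ℂ) / (z - 1)‖ ≤ 4 * D.polarOrder * ℓ :=
          hm.trans (le_mul_of_one_le_right (by positivity) hℓ)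
        have hQ' : ‖Complex.log D.Q‖ ≤ ‖Complex.log D.Q‖ * ℓ := le_mul_of_one_le_right (norm_nonneg _) hℓ
        have h20 : (20 : ℝ) ≤ 20 * ℓ := by linarith
        have hCX : C * X = K * ℓ / Real.log 2 + 20 * Real.log 7 * (K * ℓ / Real.log 2) +
            (20 * K + 20 + ‖Complex.log D.Q‖ + 3 * Cψ + 4 * D.polarOrder) * ℓ := by
          rw [hC, hℓdef]; field_simp
        rw [hCX]
        nlinarith [hG', hψ', hm', hQ', h20, hKℓ, hS0, hℓ0, hK0]

end SelbergDatum
namespace Soundararajan2004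

/-- **Good heights for the pair.** There is `C = C(F, G) > 0` such that every unit interval
`[t, t+1]` contains a height `T'` at which the horizontal segment `1/4 ≤ re s ≤ 3/4`, `im s = T'` is
free of zeros of `Φ_F Φ_G` and `‖Φ_F'/Φ_F‖ + ‖Φ_G'/Φ_G‖ ≤ C log²(2 + |t|)` on it (choose `T'` at
distance `≫ 1/log t` from the `O(log t)` nearby zeros, `SelbergDatum.exists_logDeriv_completed_le`).
These heights serve as the horizontal edges of the rectangle in the pair explicit formula (the
source's "standard application of the argument principle", p. 2, footprint of (5)).
[cite: Soundararajan2002, p. 2] -/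
theorem exists_good_height (D₁ D₂ : SelbergDatum) :
    ∃ C : ℝ, 0 < C ∧ ∀ t : ℝ, ∃ T' ∈ Icc t (t + 1), ∀ x : ℝ, 1 / 4 ≤ x → x ≤ 3 / 4 →
      D₁.completed (x + T' * I) ≠ 0 ∧ D₂.completed (x + T' * I) ≠ 0 ∧
        ‖logDeriv D₁.completed (x + T' * I)‖ + ‖logDeriv D₂.completed (x + T' * I)‖ ≤
          C * Real.log (2 + |t|) ^ 2 := by
  classical
  obtain ⟨C₁, hC₁, h₁⟩ := D₁.exists_logDeriv_completed_le
  obtain ⟨C₂, hC₂, h₂⟩ := D₂.exists_logDeriv_completed_le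
  have hlog2 : 0 < Real.log 2 := Real.log_pos one_lt_two
  set C₀ : ℝ := C₁ + C₂ with hC₀
  refine ⟨(C₀ + 2 * C₀ ^ 2) / Real.log 2 + 2 * C₀ / Real.log 2 ^ 2, by positivity, fun t ↦ ?_⟩
  obtain ⟨Z₁, m₁, hm₁0, hm₁1, hs₁, hspec₁⟩ := h₁ t
  obtain ⟨Z₂, m₂, hm₂0, hm₂1, hs₂, hspec₂⟩ := h₂ t
  obtain ⟨T', hT', hfar⟩ := exists_height_far_from (Z₁ ∪ Z₂) t
  set X : ℝ := Real.log (2 + |t|) with hX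
  have hX2 : Real.log 2 ≤ X := Real.log_le_log two_pos (by linarith [abs_nonneg t])
  have hX0 : 0 < X := hlog2.trans_le hX2
  set N : ℝ := ((Z₁ ∪ Z₂).card : ℝ) with hN
  set δ : ℝ := 1 / (2 * (N + 1)) with hδ
  have hN0 : 0 ≤ N := Nat.cast_nonneg _
  have hδ0 : 0 < δ := by rw [hδ]; positivity
  -- `N ≤ C₀ X`
  have hcard : N ≤ C₀ * X := by
    have h1 : (Z₁.card : ℝ) ≤ ∑ u ∈ Z₁, m₁ u := by
      rw [Finset.cast_card]; exact Finset.sum_le_sum fun u hu ↦ hm₁1 u hu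
    have h2 : (Z₂.card : ℝ) ≤ ∑ u ∈ Z₂, m₂ u := by
      rw [Finset.cast_card]; exact Finset.sum_le_sum fun u hu ↦ hm₂1 u hu
    have h3 : ((Z₁ ∪ Z₂).card : ℝ) ≤ Z₁.card + Z₂.card := by exact_mod_cast Finset.card_union_le Z₁ Z₂
    rw [hN, hC₀]; linarith
  refine ⟨T', hT', fun x hx1 hx2 ↦ ?_⟩
  set z : ℂ := (x : ℂ) + T' * I with hz
  have hzre : z.re = x := by simp [hz]
  have hzim : z.im = T' := by simp [hz]
  have hzZ : ∀ u ∈ Z₁ ∪ Z₂, δ ≤ ‖z - u‖ := by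
    intro u hu
    have h := hfar u hu
    calc δ ≤ |T' - u.im| := h
      _ = |(z - u).im| := by simp [hzim]
      _ ≤ ‖z - u‖ := Complex.abs_im_le_norm _
  have hzn₁ : z ∉ Z₁ := fun h ↦ by
    have := hzZ z (Finset.mem_union_left _ h); simp at this; linarith
  have hzn₂ : z ∉ Z₂ := fun h ↦ by
    have := hzZ z (Finset.mem_union_right _ h); simp at this; linarith
  obtain ⟨hΦ₁, hL₁⟩ := hspec₁ z (by rw [hzre]; exact hx1) (by rw [hzre]; exact hx2) (by rw [hzim]; exact hT'.1)
    (by rw [hzim]; exact hT'.2) hzn₁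
  obtain ⟨hΦ₂, hL₂⟩ := hspec₂ z (by rw [hzre]; exact hx1) (by rw [hzre]; exact hx2) (by rw [hzim]; exact hT'.1)
    (by rw [hzim]; exact hT'.2) hzn₂
  refine ⟨hΦ₁, hΦ₂, ?_⟩
  -- the sums over the zeros: `∑ m(u)/‖z-u‖ ≤ (∑ m(u))/δ`
  have hsum₁ : ∑ u ∈ Z₁, m₁ u / ‖z - u‖ ≤ (C₁ * X) / δ := by
    calc ∑ u ∈ Z₁, m₁ u / ‖z - u‖ ≤ ∑ u ∈ Z₁, m₁ u / δ :=
          Finset.sum_le_sum fun u hu ↦ div_le_div_of_nonneg_left (hm₁0 u) hδ0 (hzZ u (Finset.mem_union_left _ hu))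
      _ = (∑ u ∈ Z₁, m₁ u) / δ := by rw [Finset.sum_div]
      _ ≤ (C₁ * X) / δ := div_le_div_of_nonneg_right hs₁ hδ0.le
  have hsum₂ : ∑ u ∈ Z₂, m₂ u / ‖z - u‖ ≤ (C₂ * X) / δ := by
    calc ∑ u ∈ Z₂, m₂ u / ‖z - u‖ ≤ ∑ u ∈ Z₂, m₂ u / δ :=
          Finset.sum_le_sum fun u hu ↦ div_le_div_of_nonneg_left (hm₂0 u) hδ0 (hzZ u (Finset.mem_union_right _ hu))
      _ = (∑ u ∈ Z₂, m₂ u) / δ := by rw [Finset.sum_div]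
      _ ≤ (C₂ * X) / δ := div_le_div_of_nonneg_right hs₂ hδ0.le
  have hinvδ : 1 / δ = 2 * (N + 1) := by rw [hδ]; field_simp
  have htot : ‖logDeriv D₁.completed z‖ + ‖logDeriv D₂.completed z‖ ≤ C₀ * X + C₀ * X * (2 * (N + 1)) := by
    have e : (C₁ * X) / δ + (C₂ * X) / δ = C₀ * X * (2 * (N + 1)) := by
      rw [← add_div, ← hinvδ, hC₀]; ring
    linarith [hL₁, hL₂, hsum₁, hsum₂]
  refine htot.trans ?_
  -- `C₀ X + C₀ X · 2(N+1) ≤ C₀ X + 2 C₀ X (C₀ X + 1) ≤ C X²` using `X ≥ log 2`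
  have hℓ : 1 ≤ X / Real.log 2 := by rw [le_div_iff₀ hlog2, one_mul]; exact hX2
  have hC₀0 : 0 ≤ C₀ := by rw [hC₀]; positivity
  have e1 : C₀ * X ≤ C₀ * X * (X / Real.log 2) := le_mul_of_one_le_right (by positivity) hℓ
  have e2 : C₀ * X * (2 * (N + 1)) ≤ C₀ * X * (2 * (C₀ * X + 1)) := by
    apply mul_le_mul_of_nonneg_left _ (by positivity); linarith
  have e3 : C₀ * X * (2 * (C₀ * X + 1)) = 2 * C₀ ^ 2 * X ^ 2 + 2 * C₀ * X := by ring
  have e4 : 2 * C₀ * X ≤ 2 * C₀ * X * (X / Real.log 2) := le_mul_of_one_le_right (by positivity) hℓ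
  have e5 : 2 * C₀ ^ 2 * X ^ 2 ≤ 2 * C₀ ^ 2 * X ^ 2 / Real.log 2 := by
    rw [le_div_iff₀ hlog2]
    have hlt1 : Real.log 2 ≤ 1 := by have := Real.log_two_lt_d9; linarith
    have : 0 ≤ 2 * C₀ ^ 2 * X ^ 2 := by positivity
    nlinarith
  have key : C₀ * X + C₀ * X * (2 * (N + 1)) ≤
      ((C₀ + 2 * C₀ ^ 2) / Real.log 2 + 2 * C₀ / Real.log 2 ^ 2) * X ^ 2 := by
    have hexp : ((C₀ + 2 * C₀ ^ 2) / Real.log 2 + 2 * C₀ / Real.log 2 ^ 2) * X ^ 2 =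
        C₀ * X * (X / Real.log 2) + 2 * C₀ ^ 2 * X ^ 2 / Real.log 2 + 2 * C₀ * X * (X / Real.log 2) / Real.log 2 := by
      field_simp
    rw [hexp]
    have e6 : 2 * C₀ * X * (X / Real.log 2) ≤ 2 * C₀ * X * (X / Real.log 2) / Real.log 2 := by
      rw [le_div_iff₀ hlog2]
      have hlt1 : Real.log 2 ≤ 1 := by have := Real.log_two_lt_d9; linarith
      have : 0 ≤ 2 * C₀ * X * (X / Real.log 2) := by positivity
      nlinarith
    linarith
  simpa [hX] using key

end Soundararajan2004
end Literature.NumberTheory.LFunctions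

end
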